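import Summits.QuantumFields.BalabanUV.T4Continuum.Spine.NE1p.DressedRootStrict

/-!
# T⁴ programme, spine estimate NE1′ (node O3b/H2) — SEPARATION RECORD (W4 column, (t7)): THE RATE PLACE `Λ` OF ROOT-C OF
# RECORD `DressedStabilityStrict 𝒯 Λ` IS CONTENT

Cell `pub-balaban`, sub-cell `t4`, BINDER-OWNERS row NE1′; crew `b2b-balaban-t4-ne1p-formalise-*`, row **W4s** (node N29r) of
`t4/formal/NE1p/LEAVES.md` v2.6.10, BOOKED by typer RULING R-T66 (i) on INTENT CLAIMS.log l.12280; unit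
`b2b-balaban-t4-ne1p-formalise-leaf-06` (gen 3).  ADDITIVE — imports `Spine/NE1p/DressedRootStrict` ONLY (owner t4-ne1p-p1 gen 23,
**p216910**: ROOT-C OF RECORD `DressedRoot.DressedStabilityStrict 𝒯 Λ := ∃ A₀ ρ₁ τ r, DressedStabilityWith 𝒯 A₀ ρ₁ τ ∧ 0 ≤ Λ ∧ Λ·ρ₁·τ ≤ r
∧ r < 1`, the owner's disposition of GAPS G-wardbootg6-1, CLAIMS.log l.12191 (B)); theorems only, the owner's toy `growingTower` ∕
`growingBooking` and lemmas BY NAME (no re-definition, no copy); modifies nothing.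

WHAT IS DECIDED.  §1 `dressedStabilityStrict_anti` (the root is ANTITONE in `Λ`), `dressedStabilityStrict_zero_iff :
DressedStabilityStrict 𝒯 0 ↔ DressedStability 𝒯`, `exists_dressedStabilityStrict_iff` — at `Λ = 0`, or with `Λ` existentially closed,
the root of record IS the headline abbreviation (necessary, NOT sufficient: owner's `dressedStability_not_imp_dressedBudget`);
`dressedStabilityStrict_iff_lt_one` — the normal form `∃ A₀ ρ₁ τ, With ∧ 0 ≤ Λ ∧ Λ·ρ₁·τ < 1` (the auxiliary `r` is eliminable).
§2 on the DOUBLING TOWER: `two_le_rate_of_dressedStabilityWith_growingTower` (`2^K ≤ A₀(ρ₁τ)^K ∀ K` forces `ρ₁τ ≥ 2`), the EXACT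
threshold `dressedStabilityStrict_growingTower_iff : DressedStabilityStrict growingTower Λ ↔ 0 ≤ Λ ∧ Λ < 1∕2` (owner's
`not_dressedStabilityStrict_growingTower` = the instance `Λ = 1`), `dressedStabilityStrict_not_imp_dressedBudget` (at `Λ = 1∕4` the tower
PASSES the strict root, ROOT-B fails), and the count side `positionalCount_growing_iff_one_le` (unit-multiplicity counts hold iff
`1 ≤ Λ`) ⟹ `growing_rates_disjoint`: NO rate carries both — «ROOT-B fails on the doubling tower» read through the root of record.
§3 the positive pin `dressedBudget_of_dressedStabilityStrict_of_rate_le` (owner's `dressedBudget_of_dressedStabilityStrict` BY NAME after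
the two-line rate monotonicity `positionalCount_rate_mono`, proved LOCALLY so that the import list stays `DressedRootStrict` only —
S4's `positionalCount_mono` is the profile-wise form) and its sharpness `rate_domination_needed`.

THE Λ-PIN (RULING R-T66 (ii)).  Wherever a node test, LEAVES∕DAG row or END face quotes ROOT-C OF RECORD `DressedStabilityStrict 𝒯 Λ`,
`Λ` is NAMED as the positional rate of the bookings under test — cell faces `L ^ 4` (`(uniformConstantsCell …).Λ`, the rate of row
S4's `hcount`∕`hcountB`), decided towers `(Lb:ℝ)^4` ∕ `UW.Λ`, END-B `U.Λ`; with `Λ = 0` or `∃ Λ` it is the HEADLINE, not the root of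
record (§1); at or above the count rate it gives ROOT-B (§3), below it it NEED NOT (§2: the doubling tower).  Complements W4
`DressedRootSeparation` p213760 (the quantifier ORDER is content): uniform constants, the strict product, AND the rate named.
HEADLINE (c4): «the strict root's rate place is content: at Λ = 0 it is the headline, on the doubling tower the threshold is ½, and
it gives the budget root whenever Λ dominates the bookings' positional rate and need not below it; decided on the owner's toy;
nothing of Bałaban's».

HONEST FRAMING.  [folklore] bookkeeping on a decided toy; 0 `def`, 0 sorry, 0 citations.  NE1′ ⇐ the named binders, NOT proved,
NOT printed; the wall (w1), (w2-act) [THE NUMBER], (w3)⁺, (w4)–(w7) stands DISPLAYED; 0 leaves instantiated on Bałaban's densities;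
spine PROVED 0∕9.  Rung (B)+1 on ONE finite four-torus — NOT infinite volume, NOT a mass gap, NOT OS on ℝ⁴, NOT Clay, NOT summit
progress.  HONEST DEPENDENCY: continuum YM on T⁴ ⇐ BetaPertH ∧ nine spine estimates (0/9 proved); BetaPertH ⇐ (D1) ∧ (D4) ∧
CAP+tail; G-an2-4 gates asym, D1 and NE2/3/4.
-/

namespace Summit.QuantumFields.BalabanUV.T4Continuum.NE1p.DressedRootStrictSeparation

open Finset
open scoped BigOperators
open Literature.MathematicalPhysics.QuantumFieldTheory.Balaban1983to89
open Literature.MathematicalPhysics.QuantumFieldTheory.Balaban1983to89.T4TermFormat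
open Literature.MathematicalPhysics.QuantumFieldTheory.Balaban1983to89.T4TermFormat.Booking
open Summit.QuantumFields.BalabanUV.T4Continuum.NE1p.DressedRoot

variable {P : Type*}

/-! ## §1 The rate parameter: antitone; at `Λ = 0` (or `∃ Λ`) the root of record is the headline -/

/-- **ROOT-C OF RECORD IS ANTITONE IN ITS RATE** [bookkeeping]: `DressedStabilityStrict 𝒯 Λ` and `0 ≤ Λ′ ≤ Λ` give
`DressedStabilityStrict 𝒯 Λ′` (same class constants, same `r`; uses `0 ≤ ρ₁`, `0 ≤ τ` of the With-form).  A SMALLER rate is a WEAKER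
root. [folklore] -/
theorem dressedStabilityStrict_anti {𝒯 : DressedTower P} {Λ Λ' : ℝ} (h : DressedStabilityStrict 𝒯 Λ) (h0 : 0 ≤ Λ')
    (hle : Λ' ≤ Λ) : DressedStabilityStrict 𝒯 Λ' := by
  obtain ⟨A₀, ρ₁, τ, r, hW, _, hr, hr1⟩ := h
  refine ⟨A₀, ρ₁, τ, r, hW, h0, ?_, hr1⟩
  have hρτ : 0 ≤ ρ₁ * τ := mul_nonneg hW.2.1 hW.2.2.1
  calc Λ' * ρ₁ * τ = Λ' * (ρ₁ * τ) := mul_assoc _ _ _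
    _ ≤ Λ * (ρ₁ * τ) := mul_le_mul_of_nonneg_right hle hρτ
    _ = Λ * ρ₁ * τ := (mul_assoc _ _ _).symm
    _ ≤ r := hr

/-- Any displayed-constants class gives the strict root AT RATE `0` (with `r = 0`): the product clause is idle there. [folklore] -/
theorem dressedStabilityStrict_zero_of_with {𝒯 : DressedTower P} {A₀ ρ₁ τ : ℝ} (hW : DressedStabilityWith 𝒯 A₀ ρ₁ τ) :
    DressedStabilityStrict 𝒯 0 :=
  ⟨A₀, ρ₁, τ, 0, hW, le_rfl, by rw [zero_mul, zero_mul], zero_lt_one⟩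

/-- **AT RATE `0` THE ROOT OF RECORD IS THE HEADLINE** [bookkeeping]: `DressedStabilityStrict 𝒯 0 ↔ DressedStability 𝒯` — and the
headline is NOT a sufficient root (owner's `dressedStability_not_imp_dressedBudget`). [folklore] -/
theorem dressedStabilityStrict_zero_iff {𝒯 : DressedTower P} : DressedStabilityStrict 𝒯 0 ↔ DressedStability 𝒯 :=
  ⟨dressedStability_of_strict, fun ⟨_, _, _, hW⟩ => dressedStabilityStrict_zero_of_with hW⟩

/-- **WITH THE RATE EXISTENTIALLY CLOSED THE ROOT OF RECORD IS THE HEADLINE** [bookkeeping]: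
`(∃ Λ, DressedStabilityStrict 𝒯 Λ) ↔ DressedStability 𝒯`.  Quoting the root of record therefore requires NAMING `Λ`. [folklore] -/
theorem exists_dressedStabilityStrict_iff {𝒯 : DressedTower P} :
    (∃ Λ, DressedStabilityStrict 𝒯 Λ) ↔ DressedStability 𝒯 :=
  ⟨fun ⟨_, h⟩ => dressedStability_of_strict h, fun h => ⟨0, dressedStabilityStrict_zero_iff.mpr h⟩⟩

/-- **NORMAL FORM OF THE ROOT OF RECORD** [bookkeeping]: the auxiliary `r` is eliminable —
`DressedStabilityStrict 𝒯 Λ ↔ ∃ A₀ ρ₁ τ, DressedStabilityWith 𝒯 A₀ ρ₁ τ ∧ 0 ≤ Λ ∧ Λ·ρ₁·τ < 1` (take `r := Λ·ρ₁·τ`). [folklore] -/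
theorem dressedStabilityStrict_iff_lt_one {𝒯 : DressedTower P} {Λ : ℝ} :
    DressedStabilityStrict 𝒯 Λ ↔ ∃ A₀ ρ₁ τ : ℝ, DressedStabilityWith 𝒯 A₀ ρ₁ τ ∧ 0 ≤ Λ ∧ Λ * ρ₁ * τ < 1 :=
  ⟨fun ⟨A₀, ρ₁, τ, _, hW, hΛ, hr, hr1⟩ => ⟨A₀, ρ₁, τ, hW, hΛ, hr.trans_lt hr1⟩,
    fun ⟨A₀, ρ₁, τ, hW, hΛ, h1⟩ => ⟨A₀, ρ₁, τ, Λ * ρ₁ * τ, hW, hΛ, le_rfl, h1⟩⟩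

/-! ## §2 The doubling tower: the exact threshold `Λ < 1∕2`, disjoint from its count rates `Λ ≥ 1` -/

section Growing

/-- The owner's With-constants for the doubling tower, as a named theorem: `(A₀, ρ₁, τ) = (1, 2, 1)` (`dressedStability_growingTower`
proves exactly this inline). [folklore] -/
theorem dressedStabilityWith_growingTower : DressedStabilityWith growingTower 1 2 1 := by
  refine ⟨zero_le_one, by norm_num, zero_le_one, le_rfl, fun _ K b k _ _ => ?_⟩
  show (2 : ℝ) ^ k ≤ twoRate 1 2 1 K 0 k
  simp [twoRate]

/-- On the doubling tower ANY class constants dominate the top sizes: `2^K ≤ A₀·(ρ₁τ)^K` at every cutoff `K` (the one family, born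
at scale `0`, has booked size `2^K` at the final scale, and `σ 0 K = A₀·ρ₁^K·τ^K`). [folklore] -/
theorem pow_two_le_of_dressedStabilityWith_growingTower {A₀ ρ₁ τ : ℝ} (h : DressedStabilityWith growingTower A₀ ρ₁ τ)
    (K : ℕ) : (2 : ℝ) ^ K ≤ A₀ * (ρ₁ * τ) ^ K := by
  have hcl : (growingBooking K).SizeBound (twoRate A₀ ρ₁ τ K) := h.2.2.2.2 () K
  have h1 : (2 : ℝ) ^ K ≤ A₀ * ρ₁ ^ (K - 0) * τ ^ (K - 0) := hcl () K (Nat.zero_le K) le_rfl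
  rw [Nat.sub_zero, mul_assoc, ← mul_pow] at h1
  exact h1

/-- **THE DOUBLING TOWER FORCES `ρ₁·τ ≥ 2`** [bookkeeping]: if `ρ₁τ < 2` then `(2∕(ρ₁τ))^K` is unbounded (`pow_unbounded_of_one_lt`)
and exceeds `A₀`, contradicting `2^K ≤ A₀(ρ₁τ)^K`; the case `ρ₁τ = 0` fails at `K = 1`. [folklore] -/
theorem two_le_rate_of_dressedStabilityWith_growingTower {A₀ ρ₁ τ : ℝ} (h : DressedStabilityWith growingTower A₀ ρ₁ τ) :
    2 ≤ ρ₁ * τ := by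
  refine not_lt.mp fun hlt => ?_
  have hx0 : 0 ≤ ρ₁ * τ := mul_nonneg h.2.1 h.2.2.1
  rcases hx0.eq_or_lt with hx | hx
  · have h1 := pow_two_le_of_dressedStabilityWith_growingTower h 1
    rw [← hx, pow_one, pow_one, mul_zero] at h1
    linarith
  · have hy : (1 : ℝ) < 2 / (ρ₁ * τ) := by
      rw [lt_div_iff₀ hx]
      linarith
    obtain ⟨n, hn⟩ := pow_unbounded_of_one_lt A₀ hy
    have h1 := pow_two_le_of_dressedStabilityWith_growingTower h n
    have hxn : 0 < (ρ₁ * τ) ^ n := pow_pos hx n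
    have h2 : A₀ * (ρ₁ * τ) ^ n < (2 / (ρ₁ * τ)) ^ n * (ρ₁ * τ) ^ n := mul_lt_mul_of_pos_right hn hxn
    rw [div_pow, div_mul_cancel₀ _ hxn.ne'] at h2
    linarith

/-- **THE EXACT THRESHOLD** [bookkeeping, decided]: `DressedStabilityStrict growingTower Λ ↔ 0 ≤ Λ ∧ Λ < 1∕2`.  (→) `ρ₁τ ≥ 2` and
`Λρ₁τ ≤ r < 1`; (←) the owner's constants `(1, 2, 1)` with `r := 2Λ`.  The owner's `not_dressedStabilityStrict_growingTower` is the
instance `Λ = 1` — the tower's own positional rate; BELOW `1∕2` the doubling tower PASSES the strict root. [folklore] -/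
theorem dressedStabilityStrict_growingTower_iff (Λ : ℝ) :
    DressedStabilityStrict growingTower Λ ↔ 0 ≤ Λ ∧ Λ < 1 / 2 := by
  constructor
  · rintro ⟨A₀, ρ₁, τ, r, hW, hΛ, hr, hr1⟩
    refine ⟨hΛ, ?_⟩
    have h2 : Λ * 2 ≤ Λ * (ρ₁ * τ) :=
      mul_le_mul_of_nonneg_left (two_le_rate_of_dressedStabilityWith_growingTower hW) hΛ
    have h3 : Λ * (ρ₁ * τ) ≤ r := by rw [← mul_assoc]; exact hr
    linarith
  · rintro ⟨h0, hlt⟩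
    exact ⟨1, 2, 1, 2 * Λ, dressedStabilityWith_growingTower, h0, le_of_eq (by ring), by linarith⟩

/-- DECIDED INSTANCE: at rate `1∕4` the doubling tower satisfies the root of record's SHAPE. [folklore] -/
theorem dressedStabilityStrict_growingTower_quarter : DressedStabilityStrict growingTower (1 / 4) :=
  (dressedStabilityStrict_growingTower_iff _).mpr ⟨by norm_num, by norm_num⟩

/-- **THE STRICT ROOT WITH AN UN-PINNED (POSITIVE) RATE IS NOT A SUFFICIENT ROOT EITHER** [bookkeeping, decided]: there is no
implication `DressedStabilityStrict 𝒯 Λ → DressedBudget 𝒯 1` valid for all towers and all rates `Λ > 0` — the doubling tower at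
`Λ = 1∕4` has the strict root (above) and no budget (owner's `not_dressedBudget_growingTower`).  Sufficiency needs the rate pinned to
the bookings' positional rate (§3). [folklore] -/
theorem dressedStabilityStrict_not_imp_dressedBudget :
    ¬ (∀ (𝒯 : DressedTower Unit) (Λ : ℝ), 0 < Λ → DressedStabilityStrict 𝒯 Λ → DressedBudget 𝒯 (fun _ _ _ => (1 : ℝ))) :=
  fun h => not_dressedBudget_growingTower (h growingTower (1 / 4) (by norm_num) dressedStabilityStrict_growingTower_quarter)

/-- At cutoff `1`, the scale-`1` cube of the doubling tower feels exactly ONE birth of scale `0`. [folklore] -/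
theorem card_feltOfScale_growing_one :
    ((growingBooking 1).feltOfScale (⟨1, Nat.lt_succ_self 1⟩ : Fin 2) 0).card = 1 := by
  simp [Booking.feltOfScale, growingBooking]

/-- **THE DOUBLING TOWER'S COUNT RATES ARE EXACTLY `Λ ≥ 1`** [bookkeeping, decided]: unit-multiplicity positional counts
`#{births of scale j felt at a k-cube} ≤ 1·Λ^{k−j}` hold at every cutoff iff `1 ≤ Λ` ((←) one birth per cube and `1 ≤ Λ^{k−j}`;
(→) the scale-`1` cube at cutoff `1` feels the scale-`0` birth: `1 ≤ Λ`).  The owner's `positionalCount_growing` is `Λ = 1`. [folklore] -/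
theorem positionalCount_growing_iff_one_le (Λ : ℝ) :
    (∀ K, (growingBooking K).PositionalCount fun j k => 1 * Λ ^ (k - j)) ↔ 1 ≤ Λ := by
  constructor
  · intro h
    have h1 := h 1 ⟨1, Nat.lt_succ_self 1⟩ 0
    rw [card_feltOfScale_growing_one] at h1
    have h2 : (1 : ℝ) ≤ 1 * Λ ^ (1 - 0) := by exact_mod_cast h1
    simpa using h2
  · intro hΛ K q j
    have hc : ((growingBooking K).feltOfScale q j).card ≤ 1 :=
      (Finset.card_filter_le _ _).trans (by simp [growingBooking])
    calc (((growingBooking K).feltOfScale q j).card : ℝ) ≤ 1 := by exact_mod_cast hc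
      _ ≤ 1 * Λ ^ ((growingBooking K).cubeScale q - j) := by rw [one_mul]; exact one_le_pow₀ hΛ

/-- **DISJOINT RATES** [bookkeeping, decided]: on the doubling tower NO rate carries both the strict root (`Λ < 1∕2`) and the
positional counts (`Λ ≥ 1`) — the kernel content of «ROOT-B fails on the doubling tower» read through the root of record: the
implication ROOT-C-of-record ⟹ ROOT-B (`dressedBudget_of_dressedStabilityStrict`) needs BOTH at ONE rate. [folklore] -/
theorem growing_rates_disjoint {Λ : ℝ} (h : DressedStabilityStrict growingTower Λ) :
    ¬ ∀ K, (growingBooking K).PositionalCount fun j k => 1 * Λ ^ (k - j) := fun hc => by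
  have h1 := ((dressedStabilityStrict_growingTower_iff Λ).mp h).2
  have h2 := (positionalCount_growing_iff_one_le Λ).mp hc
  linarith

end Growing

/-! ## §3 The positive pin: the root of record at any rate dominating the bookings' positional rate gives ROOT-B -/

/-- Positional counts are MONOTONE in the rate: counts at rate `Λ₀` are counts at every `Λ ≥ Λ₀ ≥ 0` (multiplicity `N₀ ≥ 0`).
Proved LOCALLY (two lines; the profile-wise form is S4's `DressedPositionalCount.positionalCount_mono`, not imported — condition
(d) of row W4s: import list = `DressedRootStrict` only). [folklore] -/
theorem positionalCount_rate_mono {Bk : T4TermFormat.Booking} {N₀ Λ₀ Λ : ℝ} (hN₀ : 0 ≤ N₀) (h0 : 0 ≤ Λ₀) (hle : Λ₀ ≤ Λ)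
    (h : Bk.PositionalCount fun j k => N₀ * Λ₀ ^ (k - j)) : Bk.PositionalCount fun j k => N₀ * Λ ^ (k - j) :=
  fun q j => (h q j).trans (mul_le_mul_of_nonneg_left (pow_le_pow_left₀ h0 hle _) hN₀)

/-- **ROOT-C OF RECORD AT A DOMINATING RATE ⟹ ROOT-B** [bookkeeping]: `DressedStabilityStrict 𝒯 Λ`, K-free positional counts of
the bookings at a rate `Λ₀` with `0 ≤ Λ₀ ≤ Λ`, and run weights `0 ≤ w ≤ w̄` give `DressedBudget 𝒯 w` — the owner's
`dressedBudget_of_dressedStabilityStrict` BY NAME after raising the counts to rate `Λ`.  With §1–§2: the root of record is SUFFICIENT for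
ROOT-B whenever its rate dominates the bookings' positional rate, and need not be below it (`rate_domination_needed`); for the crew's
cell `Λ = L⁴`, the rate of row S4's counts.
Nothing instantiated on Bałaban's densities. [folklore] -/
theorem dressedBudget_of_dressedStabilityStrict_of_rate_le {𝒯 : DressedTower P} {Λ Λ₀ N₀ wbar : ℝ} {w : P → ℕ → ℕ → ℝ}
    (h : DressedStabilityStrict 𝒯 Λ) (hN₀ : 0 ≤ N₀) (h0 : 0 ≤ Λ₀) (hle : Λ₀ ≤ Λ) (hwbar : 0 ≤ wbar)
    (hw0 : ∀ p K, ∀ j ≤ K, 0 ≤ w p K j) (hwb : ∀ p K, ∀ j ≤ K, w p K j ≤ wbar)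
    (hcount : ∀ p K, (𝒯.B p K).PositionalCount fun j k => N₀ * Λ₀ ^ (k - j)) :
    DressedBudget 𝒯 w :=
  dressedBudget_of_dressedStabilityStrict h hN₀ hwbar hw0 hwb fun p K => positionalCount_rate_mono hN₀ h0 hle (hcount p K)

/-- **… AND AT A SMALLER RATE IT NEED NOT** [bookkeeping, decided]: the doubling tower has the strict root at rate `1∕4` and
unit-multiplicity counts at rate `1 > 1∕4`, yet no budget — the domination `Λ₀ ≤ Λ` in
`dressedBudget_of_dressedStabilityStrict_of_rate_le` cannot be dropped. [folklore] -/
theorem rate_domination_needed :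
    DressedStabilityStrict growingTower (1 / 4) ∧ (∀ K, (growingBooking K).PositionalCount fun j k => 1 * (1 : ℝ) ^ (k - j)) ∧
      ¬ DressedBudget growingTower (fun _ _ _ => (1 : ℝ)) :=
  ⟨dressedStabilityStrict_growingTower_quarter, (positionalCount_growing_iff_one_le 1).mpr le_rfl,
    not_dressedBudget_growingTower⟩

end Summit.QuantumFields.BalabanUV.T4Continuum.NE1p.DressedRootStrictSeparation
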